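import Literature.NumberTheory.Rogawski1990.ExplicitFactorProductFormulaGHRegular
import HarnessLib

/-!
# `Δ‴_∞(γ_H ⊗ 1, γ ⊗ 1) ≠ 0` AND `κ‴_w = ±1` AT A `(G,H)`-REGULAR (POSSIBLY `G`-SINGULAR) RATIONAL MATCHING PAIR — the archimedean complement of the
# explicit product formula under `χ_g(u) ≠ 0`

Topic `NumberTheory/Rogawski1990`; namespace `Literature.NumberTheory.Rogawski1990`.  THEOREMS ONLY (no definition, no named fact, no instance, no notation,
no `sorry`); imports ★ `ExplicitFactorProductFormulaGHRegular` (p832543; hence part 1 p832385) only.  Cell `pub/hodgecm-mathlib`, F0∕P3a, seat F0P3a-p05 (g9); brick (P-γ) of the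
#88 repair census `F0/P3a/F0P3a-p05/g9/SIZING-S1prime.F0P3a-p05g9.md` §2 rows (κ-arch)∕(κ-sign) (LEAD DESK WORDS T6-33 (b), T6-35, T6-38 (2)); finite-place
companion = F0P3a-p08 (g10)'s (P-β) `FinExplicitTransferFactorGHRegular`.

WHAT.  ★ `ArchExplicitTransferFactorNondegenerate` (N2∞) proves `Δ″_∞ ≠ 0` on matching pairs with `γ_H` **`G`-regular** (★ `IsArchNondegenerate`).  At print's
singular `γ₀ ∈ M` [Rogawski1990, Prop. 8.2.1 (b) p. 117; Lemma 14.5.2 (b) proof p. 238: `c_∞ = Δ_{G∕H}(γ₀)⁻¹` at the archimedean place] the partner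
`γ_H = (e₁•1₂, e₂)` is only `(G,H)`-regular.  For a RATIONAL pair `γ_H = (g, u) → γ` (★ `IsNormPair`) with
  `hχ : (charpoly g).eval u ≠ 0`
this file proves, by assembly of ★ only:
* (private) `isUnit_mixedEmbedding_of_ne_zero` — `t ⊗ 1` is a unit of `L ⊗ ℝ` for `t ∈ L^×` (a CM field has no real place);
* `archTau_rationalArch_ne_zero_of_eval_ne_zero` — `τ_∞(γ_H ⊗ 1) ≠ 0` (★ `archTau_rationalArch`, ★ `archHeckeValue_ne_zero_of_isUnit` at `u`, `−χ_g(u)·det g⁻¹`);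
* `archWeylRatio_rationalArch_ne_zero_of_eval_ne_zero` — `D_{G∕H,∞}(γ_H ⊗ 1) = ∏_w ‖σ_w(χ_g(u))‖ ≠ 0` (★ `archWeylRatio_rationalArch`);
* `archKappaSignAt_rationalArch_eq_one_or_eq_neg_one_of_eval_ne_zero` — `κ‴_w(γ_H ⊗ 1, γ ⊗ 1) = ±1` at every complex place (★ p832385
  `exists_kappa_eq_hilbertSymbol_of_eval_ne_zero` + ★ `QuadraticForms.hilbertSymbol_eq_one_or_eq_neg_one`; needs `hherm`, `hanis`);
* **`archCanonicalDelta_rationalArch_ne_zero_of_eval_ne_zero`** — `Δ‴_∞(γ_H ⊗ 1, γ ⊗ 1) ≠ 0` (★ `archCanonicalDelta_of_isArchNormPair`: `Δ‴_∞ = τ_∞·D_∞·∏_w κ‴_w`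
  at a matching pair).
HONEST LABEL: HC_CM is proved only modulo the printed citations until rung 0 closes; count-neutral brick toward the letter S1′ `stub_tamagawaSingularMembers_exist`
of `Cruxes/H413/Lines/F0_P3a_SingularEllipticTransferPaydown.lean` (the `c_∞ ≠ 0` DATA fact only; the archimedean κ-identity (κ-arch) itself remains print) —
no stub closes.

## References
* [Rogawski1990] J. D. Rogawski, *Automorphic Representations of Unitary Groups in Three Variables*, Ann. of Math. Stud. 123 (1990), §8.2 Prop. 8.2.1 p. 117;
  §14.5 Lemma 14.5.2 (b) proof p. 238; §4.9 p. 55; §14.6 p. 242.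
* [LanglandsShelstad1987] R. P. Langlands, D. Shelstad, *On the definition of transfer factors*, Math. Ann. 278 (1987), §2, §6.4.
-/

set_option autoImplicit false

noncomputable section

open NumberField NumberField.InfinitePlace NumberField.mixedEmbedding IsDedekindDomain Filter Matrix
open Literature.NumberTheory.GaloisRepresentations
open Literature.AlgebraicGeometry.ShimuraVarieties (hermForm)
open scoped Classical ComplexOrder MatrixGroups

namespace Literature.NumberTheory.Rogawski1990

open Literature.NumberTheory.Automorphic

variable (L : Type) [Field L] [NumberField L]

section Arch

variable [IsCMField L] (H' : Matrix (Fin 3) (Fin 3) L) (μ : HeckeCharacter L)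
  (γH : (UnitaryGroup.cmDatum L 2 (Matrix.of fun i j : Fin 2 => if i.val + j.val + 1 = 2 then (1 : L) else 0)).Rational ×
      (UnitaryGroup.cmDatum L 1 (Matrix.of fun i j : Fin 1 => if i.val + j.val + 1 = 1 then (1 : L) else 0)).Rational)
  (γ : (UnitaryGroup.cmDatum L 3 H').Rational)

omit [IsCMField L] in
/-- **`t ⊗ 1 ∈ (L ⊗ ℝ)ˣ` for `t ≠ 0`** in a CM (hence totally complex) field: every coordinate of `mixedEmbedding L t` is `σ_w(t) ≠ 0`, and there is no real
coordinate. [folklore] -/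
private theorem isUnit_mixedEmbedding_of_ne_zero [IsCMField L] {t : L} (ht : t ≠ 0) : IsUnit (mixedEmbedding L t) := by
  rw [Prod.isUnit_iff, Pi.isUnit_iff, Pi.isUnit_iff]
  refine ⟨fun v => absurd v.2 (not_isReal_iff_isComplex.mpr (IsTotallyComplex.isComplex v.1)), fun v => ?_⟩
  rw [isUnit_iff_ne_zero, mixedEmbedding_apply_isComplex]
  exact (map_ne_zero _).2 ht

/-- **`τ_∞(γ_H ⊗ 1) ≠ 0`** for a rational `γ_H = (g, u)` with `χ_g(u) ≠ 0`: `τ_∞ = μ_∞(u ⊗ 1) · μ_∞((−χ_g(u)·det g⁻¹) ⊗ 1)⁻¹` (★ `archTau_rationalArch`), two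
archimedean Hecke values at units (★ `archHeckeValue_ne_zero_of_isUnit`, ★ `tauArg_ne_zero_of_eval_ne_zero`). [cite: Rogawski1990, §4.9 p. 55] -/
theorem archTau_rationalArch_ne_zero_of_eval_ne_zero
    (hχ : ((γH.1.val.val : Matrix (Fin 2) (Fin 2) L).charpoly).eval ((γH.2.val.val : Matrix (Fin 1) (Fin 1) L) 0 0) ≠ 0) :
    archTau L (rationalArch L γH) μ ≠ 0 := by
  rw [archTau_rationalArch]
  exact mul_ne_zero (archHeckeValue_ne_zero_of_isUnit L μ (isUnit_mixedEmbedding_of_ne_zero L (gammaTwo_ne_zero L γH)))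
    (inv_ne_zero (archHeckeValue_ne_zero_of_isUnit L μ (isUnit_mixedEmbedding_of_ne_zero L (tauArg_ne_zero_of_eval_ne_zero L γH hχ))))

/-- **`D_{G∕H,∞}(γ_H ⊗ 1) ≠ 0`** for a rational `γ_H` with `χ_g(u) ≠ 0`: `D_{G∕H,∞}(γ_H ⊗ 1) = ∏_{w complex} ‖σ_w(χ_g(u))‖` (★ `archWeylRatio_rationalArch`).
[cite: Rogawski1990, §4.9 p. 55] -/
theorem archWeylRatio_rationalArch_ne_zero_of_eval_ne_zero
    (hχ : ((γH.1.val.val : Matrix (Fin 2) (Fin 2) L).charpoly).eval ((γH.2.val.val : Matrix (Fin 1) (Fin 1) L) 0 0) ≠ 0) :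
    archWeylRatio L (rationalArch L γH) ≠ 0 := by
  rw [archWeylRatio_rationalArch]
  exact Finset.prod_ne_zero_iff.2 fun w _ => norm_ne_zero_iff.2 ((map_ne_zero _).2 hχ)

/-- **`κ‴_w(γ_H ⊗ 1, γ ⊗ 1) = ±1` at every complex place** on a rational matching pair with `χ_g(u) ≠ 0` (`c`-hermitian anisotropic `H′`): `κ‴_w` is the
Hilbert symbol `(x, θ)_{w|L⁺}` of a global `x ≠ 0` (★ `exists_kappa_eq_hilbertSymbol_of_eval_ne_zero`), hence `±1` (★ `QuadraticForms.hilbertSymbol_eq_one_or_eq_neg_one`).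
«`κ(γ, ψ_v(i(γ)))` is equal to `±1`». [cite: Rogawski1990, §14.6 p. 242] [cite: LanglandsShelstad1987, §2] -/
theorem archKappaSignAt_rationalArch_eq_one_or_eq_neg_one_of_eval_ne_zero (hherm : (H'.map (cmConjRingHom L)).transpose = H')
    (hanis : ∀ x : Fin 3 → L, hermForm (cmConjRingHom L) H' x x = 0 → x = 0)
    (hχ : ((γH.1.val.val : Matrix (Fin 2) (Fin 2) L).charpoly).eval ((γH.2.val.val : Matrix (Fin 1) (Fin 1) L) 0 0) ≠ 0)
    (hγ : IsNormPair L H' γH γ) (w : {w : InfinitePlace L // IsComplex w}) :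
    archKappaSignAt L H' (rationalArch L γH) w (cmRationalToArch L 3 H' γ) = 1 ∨
      archKappaSignAt L H' (rationalArch L γH) w (cmRationalToArch L 3 H' γ) = -1 := by
  obtain ⟨x, -, -, harch⟩ := exists_kappa_eq_hilbertSymbol_of_eval_ne_zero L H' γH γ hherm hanis hχ hγ
  rw [harch w]
  exact QuadraticForms.hilbertSymbol_eq_one_or_eq_neg_one _ _

/-- **`Δ‴_∞(γ_H ⊗ 1, γ ⊗ 1) ≠ 0` AT A `(G,H)`-REGULAR RATIONAL MATCHING PAIR** (`c`-hermitian anisotropic `H′`, any Hecke character `μ`, `χ_g(u) ≠ 0`, `γ_H → γ`;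
`γ` may be singular in `G`): `Δ‴_∞ = τ_∞ · D_{G∕H,∞} · ∏_w κ‴_w` at a matching pair (★ `archCanonicalDelta_of_isArchNormPair`) with every factor non-zero by the
three lemmas above — the archimedean `c_∞ ≠ 0`-shaped DATA fact at print's singular `γ₀ ∈ M` («`c_∞ = Δ_{G∕H}(γ₀)⁻¹`»).
[cite: Rogawski1990, §8.2 Prop. 8.2.1 p. 117; §14.5 Lemma 14.5.2 (b) proof p. 238; §4.9 p. 55] -/
theorem archCanonicalDelta_rationalArch_ne_zero_of_eval_ne_zero (hherm : (H'.map (cmConjRingHom L)).transpose = H')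
    (hanis : ∀ x : Fin 3 → L, hermForm (cmConjRingHom L) H' x x = 0 → x = 0)
    (hχ : ((γH.1.val.val : Matrix (Fin 2) (Fin 2) L).charpoly).eval ((γH.2.val.val : Matrix (Fin 1) (Fin 1) L) 0 0) ≠ 0)
    (hγ : IsNormPair L H' γH γ) :
    archCanonicalDelta L H' (rationalArch L γH) μ (cmRationalToArch L 3 H' γ) ≠ 0 := by
  rw [archCanonicalDelta_of_isArchNormPair L H' (rationalArch L γH) μ (isArchNormPair_rationalArch_cmRationalToArch hγ)]
  refine mul_ne_zero (mul_ne_zero (archTau_rationalArch_ne_zero_of_eval_ne_zero L μ γH hχ)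
    (Complex.ofReal_ne_zero.2 (archWeylRatio_rationalArch_ne_zero_of_eval_ne_zero L γH hχ))) ?_
  rw [Int.cast_ne_zero]
  exact Finset.prod_ne_zero_iff.2 fun w _ => by
    rcases archKappaSignAt_rationalArch_eq_one_or_eq_neg_one_of_eval_ne_zero L H' γH γ hherm hanis hχ hγ w with h | h
    · rw [h]; exact one_ne_zero
    · rw [h]; decide

end Arch

end Literature.NumberTheory.Rogawski1990
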